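import Summits.Ventures.GridStability.Models.GFMSMIBTwinCCTLower
import Literature.MathematicalPhysics.PowerSystems.SMIBEqualAreaCriterion

/-!
# GridStability/Models/GFMSMIBTwinCCTUpper — the clearing time of the §V-consistent twin «GFM-SMIB-QoriaV5s» is BRACKETED: every bolted fault of duration ≥ 0.74 s ends in a pole slip (kernel UPPER bound, 0 kit); with `GFMSMIBTwinCCTLower` (≤ 0.70 s recovers): `0.70 s ≤ CCT(M_twin) ≤ 0.74 s`

Cell `gridfusion` (LADDER-GRIDFUSION rung G3.a, thread «G3.a-cct»; seat gridfusion-model-3 (g10)).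
`GFMSMIBTwinCCTLower.lean` (p552112, #114-cand «G3.a-TWIN-CCT-LOWER») certifies the LOWER side on the
twin record `gfmQoriaV5sPhys` (`M = 113/3550`, `D = 113/1420`, `P_m′ = 8290560/16581121`, `P_M = 4`,
`δˢ = arcsin(2072640/16581121)`; droop GFM ≡ SMIB, `ω_c = 5/2`, `k_i p*′ = kpTwin`): every fault of
duration `T ≤ 7/10` s is recovered (angle window kept for ever, `X → (δˢ, 0)`).  THIS FILE certifies the
UPPER side with lit-1's unstable-side energy criterion in THRESHOLD form
(`Literature…SMIB.poleSlip_of_clearing_ge`, p504520 ff.: positive excess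
`V_cr + m + D ω_c (δ^u − δ_c) ≤ V(δ_c, ω_c)` at a lower corner of the cleared state, transported along
the monotone fault-on arc; cleared past `δ^u` the positive speed alone forces the slip
[cite: SauerPai1998, §9.6.2 (text after (9.36)), §9.6.3 (9.48); Kundur1994, §13.1.3]):
* the twin's fault-on arc in SMIB coordinates IS a zero-power fault arc WITH the droop «damping» in force:
  `δ_F′ = Ω_F`, `Ω_F′ = (P_m′ − D Ω_F)/M` (`D/M = ω_c = 5/2`, `P_m′/M = (5/2)·kpTwin`), solved by the
  two components of the closed form `twinFaultOnState` (model-3 (P25); `hasDerivAt_twinFaultOnState_angle`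
  / `_speed`);
* kernel numerals: `e^{−37/40} ∈ [0.396504, 0.396535]` (`Real.exp_bound`, eight terms) ⇒ lower corner of
  the cleared state at `T_u = 37/50`: `δ_F(0.74) ≥ 2.6567`, `Ω_F(0.74) ≥ 5.2952`; `V_cr < 6.4919`;
  `cos 2.6567 ≤ cosUpper4 2.6567` (model-1's chain) ⇒ `V_PE(2.6567) ≥ 6.2403`; damper-work allowance
  `D Ω_lo (δ^u − δ_lo) ≤ 0.1516`; excess margin `m = 1/100` (float excess at the corner `+0.045`).
DECIDING THEOREM `twin_poleSlip_of_clearing_ge`: for EVERY fault duration `T ≥ 37/50` s and every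
solution `X` of the twin SMIB model on `[0, ∞)` started at the fault-on state `X_F(T)`: at some `t ≥ 0`,
`δ(t) − δˢ > π` (pole slip; the negation of the window clause of `twin_cct_lower`).  COROLLARY
`twin_cct_bracket`: both sides in one statement — the critical clearing time of MODEL M_twin for a bolted
terminal fault from the operating point lies in `[0.70, 0.74]` s (40 ms wide).
THREE COLUMNS.  CERTIFIED: the two sentences above about M_twin (droop GFM ≡ SMIB, MV-6D + MV-P + MV-Ω +
P-INV-7; bolted fault `p_mes ≡ 0`; no limiter, no virtual impedance).  VALIDATED (floats, never used):
RK4 on M_twin puts the model's CCT at `0.727 s`; the excess criterion first holds at `0.7355 s`; the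
cleared angle passes `δ^u` at `0.807 s`; the print's «498 ms» [cite: Qoria2020, §V.3.6] is the VI-equipped
converter — context only.  MODELLED: statements about the MODEL; nothing here says a converter is stable
or unstable.
-/

noncomputable section

open Real Set Filter Topology
open Summit.Ventures.GridStability.Models.AngleEnclosure

namespace Summit.Ventures.GridStability.Models.SMIB

open InverterDroop

/-! ## The record, its critical energy from above -/

/-- The twin record is lossless-reduced (`γ = 0`), so model-1's dictionary `toLit` is faithful. -/
theorem gfmQoriaV5sPhys_γ : gfmQoriaV5sPhys.γ = 0 := rfl

/-- Certified rational over-approximation `V_cr(δˢ) < 6.4919` for the twin (float `6.4917855`;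
from `δˢ < 0.1254` and `π > 3.141592`). -/
theorem twin_criticalEnergy_lt :
    gfmQoriaV5sPhys.toLit.criticalEnergy deltaQV4 < 64919 / 10000 := by
  rw [twin_criticalEnergy_eq, gfmQoriaV4Phys_criticalEnergy_eq]
  have hπ := Real.pi_gt_d6
  have hδ := deltaQV4_lt
  norm_num [cQV4] at hπ hδ ⊢
  nlinarith

/-! ## The fault-on arc `T ↦ X_F(T)` as a solution of the zero-power fault equation -/

/-- The fault starts from rest: `Ω_F(0) = (X_F 0).2 = 0`. -/
theorem twinFaultOnState_speed_zero : (twinFaultOnState 0).2 = 0 := by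
  simp [twinFaultOnState]

/-- The fault-on SPEED `Ω_F(t) = (X_F t).2 = kpTwin (1 − e^{−(5/2)t})` solves the zero-power fault
equation WITH the droop «damping» in force: `Ω_F′ = (P_m′ − D Ω_F)/M` (`(5/2)·kpTwin = P_m′/M`,
`D/M = ω_c = 5/2`, exact rationals). [cite: Qoria2020, §V.3.6 (fault-on stage of (III-46))] -/
theorem hasDerivAt_twinFaultOnState_speed (t : ℝ) :
    HasDerivAt (fun s : ℝ => (twinFaultOnState s).2)
      ((gfmQoriaV5sPhys.toLit.Pm - gfmQoriaV5sPhys.toLit.D * (twinFaultOnState t).2) /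
        gfmQoriaV5sPhys.toLit.M) t := by
  have he : HasDerivAt (fun s : ℝ => exp (-(5 / 2) * s)) (exp (-(5 / 2) * t) * (-(5 / 2) * 1)) t :=
    ((hasDerivAt_id t).const_mul (-(5 / 2 : ℝ))).exp
  have h : HasDerivAt (fun s : ℝ => kpTwin * (1 - exp (-(5 / 2) * s)))
      (kpTwin * (0 - exp (-(5 / 2) * t) * (-(5 / 2) * 1))) t :=
    ((hasDerivAt_const t (1 : ℝ)).sub he).const_mul kpTwin
  have hfun : (fun s : ℝ => (twinFaultOnState s).2) = fun s : ℝ => kpTwin * (1 - exp (-(5 / 2) * s)) :=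
    rfl
  rw [hfun]
  refine h.congr_deriv ?_
  rw [gfmQoriaV5sPhys_toLit]
  dsimp only [twinFaultOnState]
  simp only [kpTwin]
  ring

/-- The fault-on ANGLE `δ_F(t) = (X_F t).1 = δˢ + kpTwin (t − (1 − e^{−(5/2)t})/(5/2))` has the fault-on
speed as its derivative: `δ_F′ = Ω_F`. -/
theorem hasDerivAt_twinFaultOnState_angle (t : ℝ) :
    HasDerivAt (fun s : ℝ => (twinFaultOnState s).1) ((twinFaultOnState t).2) t := by
  have he : HasDerivAt (fun s : ℝ => exp (-(5 / 2) * s)) (exp (-(5 / 2) * t) * (-(5 / 2) * 1)) t :=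
    ((hasDerivAt_id t).const_mul (-(5 / 2 : ℝ))).exp
  have h1 : HasDerivAt (fun s : ℝ => 1 - exp (-(5 / 2) * s)) (0 - exp (-(5 / 2) * t) * (-(5 / 2) * 1)) t :=
    (hasDerivAt_const t (1 : ℝ)).sub he
  have h2 : HasDerivAt (fun s : ℝ => s - (1 - exp (-(5 / 2) * s)) / (5 / 2))
      (1 - (0 - exp (-(5 / 2) * t) * (-(5 / 2) * 1)) / (5 / 2)) t :=
    (hasDerivAt_id' t).sub (h1.div_const (5 / 2))
  have h3 : HasDerivAt (fun s : ℝ => deltaQV4 + kpTwin * (s - (1 - exp (-(5 / 2) * s)) / (5 / 2)))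
      (kpTwin * ((1 - (0 - exp (-(5 / 2) * t) * (-(5 / 2) * 1)) / (5 / 2)))) t :=
    (h2.const_mul kpTwin).const_add deltaQV4
  have hfun : (fun s : ℝ => (twinFaultOnState s).1) =
      fun s : ℝ => deltaQV4 + kpTwin * (s - (1 - exp (-(5 / 2) * s)) / (5 / 2)) :=
    rfl
  rw [hfun]
  refine h3.congr_deriv ?_
  dsimp only [twinFaultOnState]
  ring

/-! ## Kernel numerals at the threshold `T_u = 37/50` -/

/-- `e^{−37/40} ∈ [0.396504, 0.396535]` (`Real.exp_bound`, eight terms; float `0.3965314`). -/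
theorem exp_neg_37_40_bounds :
    (49563 / 125000 : ℝ) ≤ exp (-(37 / 40)) ∧ exp (-(37 / 40)) ≤ 79307 / 200000 := by
  have h := Real.exp_bound (x := -(37 / 40 : ℝ)) (by rw [abs_le]; constructor <;> norm_num)
    (n := 8) (by norm_num)
  simp only [Finset.sum_range_succ, Finset.sum_range_zero, Nat.factorial, Nat.succ_eq_add_one] at h
  norm_num at h
  rw [abs_le] at h
  constructor <;> linarith [h.1, h.2]

/-- `e^{−37/20} ∈ [0.396504², 0.396535²] ⊂ [0.15721, 0.15725]` (square of the previous; float `0.1572372`). -/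
theorem exp_neg_37_20_bounds :
    (49563 / 125000 : ℝ) ^ 2 ≤ exp (-(37 / 20)) ∧ exp (-(37 / 20)) ≤ (79307 / 200000 : ℝ) ^ 2 := by
  obtain ⟨h1, h2⟩ := exp_neg_37_40_bounds
  have hsq : exp (-(37 / 20 : ℝ)) = exp (-(37 / 40)) * exp (-(37 / 40)) := by
    rw [← Real.exp_add]; norm_num
  have h0 : 0 ≤ exp (-(37 / 40 : ℝ)) := (exp_pos _).le
  rw [hsq]
  constructor <;> nlinarith

/-- **Lower corner of the cleared state at `T_u = 0.74 s`:** `δ_F(37/50) ≥ 2.6567` and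
`Ω_F(37/50) ≥ 5.2952` (floats `2.65679`, `5.29524`). -/
theorem twinFaultOn_corner :
    (26567 / 10000 : ℝ) ≤ (twinFaultOnState (37 / 50)).1 ∧
      (6619 / 1250 : ℝ) ≤ (twinFaultOnState (37 / 50)).2 := by
  obtain ⟨hE1, hE2⟩ := exp_neg_37_20_bounds
  have h74 : exp (-(5 / 2 : ℝ) * (37 / 50)) = exp (-(37 / 20)) := by norm_num
  have hδs := deltaQV4_gt
  constructor
  · simp only [twinFaultOnState, h74]
    norm_num [kpTwin] at hE1 hδs ⊢
    nlinarith
  · simp only [twinFaultOnState, h74]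
    norm_num [kpTwin] at hE2 ⊢
    nlinarith

/-! ## The certified upper bound -/

/-- **Every clearing time `T ≥ 0.74 s` ends in a pole slip for MODEL M_twin («GFM-SMIB-QoriaV5s»).**
For every fault duration `T ≥ 37/50` s and every solution `X` of the twin SMIB model on `[0, ∞)` started
at the closed-form fault-on state `X_F(T)` (bolted terminal fault from the operating point `(δˢ, 0)`):
there is `t ≥ 0` with `δ(t) − δˢ > π` — the virtual rotor of the model slips a pole; in particular the
window clause `δ(t) < π − δˢ ∀ t ≥ 0` of `twin_cct_lower` FAILS.  Proof = lit-1's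
`SMIB.poleSlip_of_clearing_ge` through model-1's dictionary `toLit`, fed with the closed-form fault-on arc,
the corner `(2.6567, 5.2952)` at `T_u = 37/50`, `V_cr < 6.4919`, `V_PE(2.6567) ≥ 6.2403`, excess `m = 1/100`.
MODELLED: MV-6D + MV-P + MV-Ω + P-INV-7, no VI / limiter; nothing about a device.
[cite: SauerPai1998, §9.6.2 (text after (9.36)) and §9.6.3 (9.48); Kundur1994, §13.1.3; Qoria2020, §V.3.6] -/
theorem twin_poleSlip_of_clearing_ge {T : ℝ} (hT : 37 / 50 ≤ T) {X : ℝ → ℝ × ℝ}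
    (hX : gfmQoriaV5sPhys.IsSolutionOn X (Ici 0)) (h0 : X 0 = twinFaultOnState T) :
    ∃ t : ℝ, 0 ≤ t ∧ π < (X t).1 - deltaQV4 := by
  -- the post-fault record and its facts
  set p := gfmQoriaV5sPhys.toLit with hp
  have hpv : p = ⟨113 / 3550, 113 / 1420, 8290560 / 16581121, 4⟩ := gfmQoriaV5sPhys_toLit
  have hM : 0 < p.M := by rw [hpv]; norm_num
  have hD : 0 ≤ p.D := by rw [hpv]; norm_num
  have hPmax : 0 < p.Pmax := by rw [hpv]; norm_num
  have heq : p.IsEquilibriumAngle deltaQV4 :=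
    (toLit_isEquilibriumAngle_iff gfmQoriaV5sPhys_γ deltaQV4).2 gfmQoriaV5sPhys_isEquilibrium
  have hXlit : ∀ S : ℝ, ∀ t ∈ Icc 0 S, HasDerivWithinAt X (p.vectorField (X t)) (Icc 0 S) t :=
    fun S => (isSolutionOn_iff_toLit gfmQoriaV5sPhys_γ X _).1 (hX.restrict_Icc S)
  -- the fault-on arc on `[0, T]`
  have hδF : ∀ t ∈ Icc 0 T, HasDerivWithinAt (fun s : ℝ => (twinFaultOnState s).1)
      ((fun s : ℝ => (twinFaultOnState s).2) t) (Icc 0 T) t :=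
    fun t _ => (hasDerivAt_twinFaultOnState_angle t).hasDerivWithinAt
  have hωF : ∀ t ∈ Icc 0 T, HasDerivWithinAt (fun s : ℝ => (twinFaultOnState s).2)
      ((p.Pm - p.D * (fun s : ℝ => (twinFaultOnState s).2) t) / p.M) (Icc 0 T) t :=
    fun t _ => (hasDerivAt_twinFaultOnState_speed t).hasDerivWithinAt
  -- enclosures
  obtain ⟨hδlo, hωlo⟩ := twinFaultOn_corner
  have hδs_lo := deltaQV4_gt
  have hδs_hi := deltaQV4_lt
  have hπlo := Real.pi_gt_d6
  have hπhi := Real.pi_lt_d6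
  have hVcr := twin_criticalEnergy_lt
  rw [← hp] at hVcr
  -- damping condition `(D/M)(δ^u − δ_lo) ≤ ω_lo`
  have hDM : p.D / p.M = 5 / 2 := by rw [hpv]; norm_num
  have hωlo_D : p.D / p.M * (π - deltaQV4 - 26567 / 10000) ≤ 6619 / 1250 := by
    rw [hDM]
    norm_num at hπhi hδs_lo ⊢
    nlinarith
  -- potential energy at the corner angle from below
  have hcos : cos (26567 / 10000 : ℝ) ≤ cosUpper4 (26567 / 10000) :=
    cos_le_cosUpper4 (by norm_num) (by linarith [pi_gt_three])
  have hPE : (62403 / 10000 : ℝ) ≤ p.potentialEnergy deltaQV4 (26567 / 10000) := by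
    rw [hpv]
    unfold Literature.MathematicalPhysics.PowerSystems.SMIB.potentialEnergy
    rw [cos_deltaQV4]
    norm_num [dbl, cosUpper4, cQV4] at hcos hδs_lo ⊢
    nlinarith
  have hKE : (1 : ℝ) / 2 * p.M * (6619 / 1250) ^ 2 = 4950661193 / 11093750000 := by
    rw [hpv]; norm_num
  have hallow : p.D * (6619 / 1250) * (π - deltaQV4 - 26567 / 10000) ≤ 379 / 2500 := by
    rw [hpv]
    norm_num at hπhi hδs_lo ⊢
    nlinarith
  have hexcess : p.criticalEnergy deltaQV4 + 1 / 100 + p.D * (6619 / 1250) * (π - deltaQV4 - 26567 / 10000)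
      ≤ p.energy deltaQV4 (26567 / 10000, 6619 / 1250) := by
    have hE : p.energy deltaQV4 (26567 / 10000, 6619 / 1250)
        = 1 / 2 * p.M * (6619 / 1250) ^ 2 + p.potentialEnergy deltaQV4 (26567 / 10000) := rfl
    rw [hE, hKE]
    norm_num at hVcr hPE hallow ⊢
    linarith
  -- lit-1's threshold theorem
  have hX0 : X 0 = ((fun s : ℝ => (twinFaultOnState s).1) T, (fun s : ℝ => (twinFaultOnState s).2) T) := by
    rw [h0]
  exact p.poleSlip_of_clearing_ge hM hD hPmax heq deltaQV4_pos.le deltaQV4_lt_pi_div_two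
    (Df := p.D) (T := T) (Tu := 37 / 50) (by norm_num) hδF hωF twinFaultOnState_speed_zero
    (δlo := 26567 / 10000) (ωlo := 6619 / 1250) (m := 1 / 100) (by norm_num) (by norm_num)
    (by norm_num at hδs_hi ⊢; linarith) hδlo hωlo hωlo_D hexcess hT le_rfl hX0 hXlit

/-- A solution of the twin model on every `[0, S]` (the convention of lit-1's existence theorem) is a
solution on `[0, ∞)` (the convention of the clearing-time theorems): the within-derivative at `t ≥ 0`
only sees `[0, t + 1]`. [folklore] -/
theorem twin_isSolutionOn_Ici_of_forall_Icc {X : ℝ → ℝ × ℝ}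
    (hX : ∀ S : ℝ, gfmQoriaV5sPhys.IsSolutionOn X (Icc 0 S)) :
    gfmQoriaV5sPhys.IsSolutionOn X (Ici 0) := by
  intro t ht
  have h1 := hX (t + 1) t ⟨ht, by linarith⟩
  refine h1.mono_of_mem_nhdsWithin ?_
  have hn : Iio (t + 1) ∈ 𝓝 t := Iio_mem_nhds (by linarith)
  exact mem_of_superset (inter_mem_nhdsWithin (Ici 0) hn) fun s hs => ⟨hs.1, le_of_lt hs.2⟩

/-- **Non-vacuity:** from every cleared state `X_F(T)` the twin model HAS a solution on `[0, ∞)`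
(lit-1's Cauchy–Lipschitz `SMIB.exists_globalSolution` through the dictionary) — the classes of motions
quantified over in `twin_cct_lower` / `twin_poleSlip_of_clearing_ge` are non-empty.
[cite: Teschl2012, Thm. 2.2 and Cor. 2.6] -/
theorem twin_exists_solution (T : ℝ) :
    ∃ X : ℝ → ℝ × ℝ, X 0 = twinFaultOnState T ∧ gfmQoriaV5sPhys.IsSolutionOn X (Ici 0) := by
  obtain ⟨X, h0, hX⟩ := gfmQoriaV5sPhys.toLit.exists_globalSolution (twinFaultOnState T)
  exact ⟨X, h0, twin_isSolutionOn_Ici_of_forall_Icc fun S =>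
    (isSolutionOn_iff_toLit gfmQoriaV5sPhys_γ X _).2 (hX S)⟩

/-- **The clearing-time BRACKET of MODEL M_twin: `0.70 s ≤ CCT ≤ 0.74 s`.**  (i) every fault duration
`T ∈ [0, 7/10]`: every solution from `X_F(T)` keeps `δ ∈ (−π − δˢ, π − δˢ)` and energy `≤ 6.4917` for
ever and tends to `(δˢ, 0)` (`twin_cct_lower`, p552112); (ii) every fault duration `T ≥ 37/50`: every
solution from `X_F(T)` slips a pole (`δ(t) − δˢ > π` at some `t ≥ 0`) and so violates the window clause
of (i).  CERTIFIED for MODEL M_twin (bolted terminal fault from the operating point; no VI / limiter);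
VALIDATED float CCT of the model `0.727 s` (RK4, not used); nothing about a device. -/
theorem twin_cct_bracket :
    (∀ T : ℝ, 0 ≤ T → T ≤ 7 / 10 → ∀ X : ℝ → ℝ × ℝ, gfmQoriaV5sPhys.IsSolutionOn X (Ici 0) →
        X 0 = twinFaultOnState T →
        (∀ t, 0 ≤ t → (X t).1 ∈ Ioo (-π - deltaQV4) (π - deltaQV4) ∧
            gfmQoriaV5sPhys.energy deltaQV4 (X t) ≤ 64917 / 10000) ∧
          Tendsto X atTop (𝓝 (deltaQV4, 0))) ∧
    (∀ T : ℝ, 37 / 50 ≤ T → ∀ X : ℝ → ℝ × ℝ, gfmQoriaV5sPhys.IsSolutionOn X (Ici 0) →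
        X 0 = twinFaultOnState T →
        (∃ t : ℝ, 0 ≤ t ∧ π < (X t).1 - deltaQV4) ∧
          ¬ (∀ t, 0 ≤ t → (X t).1 ∈ Ioo (-π - deltaQV4) (π - deltaQV4))) := by
  refine ⟨fun T hT0 hT X hX h0 => twin_cct_lower hT0 hT hX h0, fun T hT X hX h0 => ?_⟩
  obtain ⟨t, ht, hslip⟩ := twin_poleSlip_of_clearing_ge hT hX h0
  refine ⟨⟨t, ht, hslip⟩, fun hwin => ?_⟩
  have h := (hwin t ht).2
  linarith [deltaQV4_pos]

end Summit.Ventures.GridStability.Models.SMIB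

end
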